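import Literature.AlgebraicGeometry.Resolution.WeightedCentreLayerEquation
import Mathlib.RingTheory.MvPolynomial.WeightedHomogeneous
import HarnessLib

/-!
# LEMMA N_E: unpinning a class of weight `E > 1/(p+1)` (T35)

INSTRUMENT, NOT a resolution theorem: the arithmetic + polynomial-algebra core of LEMMA N_E of
ENGINE 1's polynomial weighted-centre toy model `W(f)` (THEOREM-FS eng1-g35 §12.1, CARVER task T35).

Setting: rational weights `w : σ → ℚ`; a polynomial `S` supported on monomials of `w`-weight `1`
(`IsWeightedHomogeneous w S 1`) all of whose variables weigh at least `E`, where `E = w e₀` is the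
weight of a distinguished variable `e₀` and `(p + 1) · E > 1` (for `p = 5`: `E > 1/6`).

* ARITHMETIC CORE (`apply_lt_or_eq_single`): for such a monomial `m`, `E · m(e₀) ≤ 1` forces
  `m(e₀) ≤ p`, and `m(e₀) = p` forces `m = e₀^p` together with `p · E = 1` (a further variable would
  add at least `E` to the weight: `(p+1)E ≤ 1`, excluded).  No primality is used here.
* LEMMA N_E (`notMem_vars_of_pderiv_eq_zero_of_weightOne`, characteristic `p`): if moreover
  `∂_{e₀} S = 0` and — only needed when `p · E = 1` — the pure monomial `e₀^p` does not occur in `S`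
  (hypothesis (Q) of THEOREM-FS), then `e₀` does not occur in `S` at all: every exponent of `e₀` is
  `< p`, so the tree lemma `notMem_vars_of_pderiv_eq_zero` (`WeightedCentreLayerEquation`, N_F)
  applies.  The directional form `Σ_e b_e ∂_e S = 0` (with `b` supported on the class of weight `E`)
  reduces to `∂_{e₀}` by the line substitution of `WeightedCentreDirectionalDerivative`
  (`pderiv_lineSubst_eq_zero`); the U-slot lemmas N_N, N_{N′}, N_W, N_M are the same statement.

NOT a statement about the Abramovich–Temkin–Włodarczyk invariant, NOT summit progress; AI-written,
AI review is weaker than expert review.  References (context only): [Hironaka1970AdditiveGroups]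
(additive forms and differential operators); [AbramovichTemkinWlodarczyk2024] §5 (the weights of a
weighted centre).
-/

open MvPolynomial

namespace Literature.AlgebraicGeometry.Resolution.WeightedBlowup

namespace UnpinE

/-! ## Arithmetic core: exponents of a variable of weight `E > 1/(p+1)` in a weight-one monomial -/

section Arithmetic

variable {σ : Type*}

/-- If every variable occurring in `m` weighs at least `E`, then `wt(m) ≥ |m| · E`. (derived here)
[cite: AbramovichTemkinWlodarczyk2024, §5] -/
theorem degree_mul_le_weight (w : σ → ℚ) (E : ℚ) (m : σ →₀ ℕ)
    (hge : ∀ i ∈ m.support, E ≤ w i) : (m.degree : ℚ) * E ≤ Finsupp.weight w m := by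
  rw [Finsupp.weight_apply, Finsupp.sum, Finsupp.degree_apply, Nat.cast_sum, Finset.sum_mul]
  refine Finset.sum_le_sum fun i hi => ?_
  rw [nsmul_eq_mul]
  exact mul_le_mul_of_nonneg_left (hge i hi) (Nat.cast_nonneg _)

/-- Splitting the weight at one variable: `wt(m) = m(e₀) · w(e₀) + wt(m ∖ e₀)`. (derived here)
[cite: AbramovichTemkinWlodarczyk2024, §5] -/
theorem weight_eq_add_erase (w : σ → ℚ) (m : σ →₀ ℕ) (e₀ : σ) :
    Finsupp.weight w m = (m e₀ : ℚ) * w e₀ + Finsupp.weight w (m.erase e₀) := by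
  conv_lhs => rw [← Finsupp.single_add_erase e₀ m]
  rw [map_add, Finsupp.weight_single, nsmul_eq_mul]

/-- **Arithmetic core of LEMMA N_E.**  Let `w e₀ = E` with `(p+1) · E > 1`, and let `m` be a
monomial of weight `1` all of whose variables weigh `≥ E`.  Then either `m(e₀) < p`, or `m = e₀^p`
and `p · E = 1`. (derived here) [cite: AbramovichTemkinWlodarczyk2024, §5] -/
theorem apply_lt_or_eq_single (w : σ → ℚ) {E : ℚ} (p : ℕ) (hE : 1 < ((p : ℚ) + 1) * E) {e₀ : σ}
    (hw₀ : w e₀ = E) {m : σ →₀ ℕ} (hm : Finsupp.weight w m = 1)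
    (hge : ∀ i ∈ m.support, E ≤ w i) :
    m e₀ < p ∨ (m = Finsupp.single e₀ p ∧ (p : ℚ) * E = 1) := by
  classical
  have hE0 : 0 ≤ E := by
    by_contra h
    have hp1 : (0 : ℚ) < (p : ℚ) + 1 := by positivity
    nlinarith
  have hsplit := weight_eq_add_erase w m e₀
  have hge' : ∀ i ∈ (m.erase e₀).support, E ≤ w i := by
    intro i hi
    rw [Finsupp.support_erase] at hi
    exact hge i (Finset.mem_of_mem_erase hi)
  have hrest := degree_mul_le_weight w E (m.erase e₀) hge'
  have hrest0 : 0 ≤ Finsupp.weight w (m.erase e₀) :=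
    le_trans (mul_nonneg (Nat.cast_nonneg _) hE0) hrest
  rw [hm, hw₀] at hsplit
  by_cases hnp : m e₀ < p
  · exact Or.inl hnp
  right
  have hpn : p ≤ m e₀ := not_lt.mp hnp
  have hnle : m e₀ ≤ p := by
    by_contra h
    have h' : (p : ℚ) + 1 ≤ (m e₀ : ℚ) := by exact_mod_cast (by omega : p + 1 ≤ m e₀)
    nlinarith
  have hneq : m e₀ = p := le_antisymm hnle hpn
  rw [hneq] at hsplit
  have herase : m.erase e₀ = 0 := by
    by_contra hne
    have hdeg : 1 ≤ (m.erase e₀).degree :=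
      Nat.one_le_iff_ne_zero.mpr fun h => hne ((Finsupp.degree_eq_zero_iff _).mp h)
    have hdeg' : (1 : ℚ) ≤ ((m.erase e₀).degree : ℚ) := by exact_mod_cast hdeg
    nlinarith
  refine ⟨?_, ?_⟩
  · rw [← Finsupp.single_add_erase e₀ m, herase, add_zero, hneq]
  · rw [herase, map_zero, add_zero] at hsplit
    linarith

/-- Consequently, if the pure monomial `e₀^p` is excluded whenever `p · E = 1`, every exponent of
`e₀` is `< p`. (derived here) [cite: AbramovichTemkinWlodarczyk2024, §5] -/
theorem apply_lt (w : σ → ℚ) {E : ℚ} (p : ℕ) (hE : 1 < ((p : ℚ) + 1) * E) {e₀ : σ}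
    (hw₀ : w e₀ = E) {m : σ →₀ ℕ} (hm : Finsupp.weight w m = 1)
    (hge : ∀ i ∈ m.support, E ≤ w i) (hQ : (p : ℚ) * E = 1 → m ≠ Finsupp.single e₀ p) :
    m e₀ < p := by
  rcases apply_lt_or_eq_single w p hE hw₀ hm hge with h | ⟨hm', hpE⟩
  · exact h
  · exact absurd hm' (hQ hpE)

/-- The case `p · E ≠ 1` (for `p = 5`: `E ≠ 1/5`): every exponent of `e₀` is `≤ p − 1`
unconditionally. (derived here) [cite: AbramovichTemkinWlodarczyk2024, §5] -/
theorem apply_lt_of_ne (w : σ → ℚ) {E : ℚ} (p : ℕ) (hE : 1 < ((p : ℚ) + 1) * E)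
    (hpE : (p : ℚ) * E ≠ 1) {e₀ : σ} (hw₀ : w e₀ = E) {m : σ →₀ ℕ} (hm : Finsupp.weight w m = 1)
    (hge : ∀ i ∈ m.support, E ≤ w i) : m e₀ < p :=
  apply_lt w p hE hw₀ hm hge fun h => absurd h hpE

end Arithmetic

/-! ## LEMMA N_E: `∂_{e₀} S = 0 ⇒ e₀ ∉ vars S` in characteristic `p` -/

section CharP

variable {K : Type*} [Field K] {σ : Type*}

/-- **LEMMA N_E (typed core).**  In characteristic `p`, let `S` be supported on monomials of
`w`-weight `1` whose variables all weigh `≥ E = w e₀`, with `(p+1) · E > 1`; assume `∂_{e₀} S = 0`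
and, in case `p · E = 1`, that `e₀^p` does not occur in `S` (hypothesis (Q)).  Then `e₀` does not
occur in `S`. (derived here) [cite: Hironaka1970AdditiveGroups, additive forms and differential operators]
[cite: AbramovichTemkinWlodarczyk2024, §5] -/
theorem notMem_vars_of_pderiv_eq_zero_of_weightOne (p : ℕ) [CharP K p] (w : σ → ℚ) {E : ℚ}
    (hE : 1 < ((p : ℚ) + 1) * E) {e₀ : σ} (hw₀ : w e₀ = E) {S : MvPolynomial σ K}
    (hS : IsWeightedHomogeneous w S (1 : ℚ)) (hge : ∀ m ∈ S.support, ∀ i ∈ m.support, E ≤ w i)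
    (hD : pderiv e₀ S = 0) (hQ : (p : ℚ) * E = 1 → coeff (Finsupp.single e₀ p) S = 0) :
    e₀ ∉ S.vars :=
  notMem_vars_of_pderiv_eq_zero p hD fun d hd =>
    apply_lt w p hE hw₀ (hS (mem_support_iff.mp hd)) (hge d hd) fun hpE hdeq =>
      (mem_support_iff.mp hd) (hdeq ▸ hQ hpE)

/-- **LEMMA N_E at `p = 5`** (THEOREM-FS §12.1): `E > 1/6`, weight-one `S` in variables of weight
`≥ E`, `∂_{e₀} S = 0`, and `coeff (e₀^5) S = 0` if `E = 1/5` ⇒ `e₀ ∉ vars S`. (derived here)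
[cite: AbramovichTemkinWlodarczyk2024, §5] -/
theorem notMem_vars_five [CharP K 5] (w : σ → ℚ) {E : ℚ} (hE : 1/6 < E) {e₀ : σ}
    (hw₀ : w e₀ = E) {S : MvPolynomial σ K} (hS : IsWeightedHomogeneous w S (1 : ℚ))
    (hge : ∀ m ∈ S.support, ∀ i ∈ m.support, E ≤ w i) (hD : pderiv e₀ S = 0)
    (hQ : E = 1/5 → coeff (Finsupp.single e₀ 5) S = 0) : e₀ ∉ S.vars :=
  notMem_vars_of_pderiv_eq_zero_of_weightOne 5 w (by push_cast; linarith) hw₀ hS hge hD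
    fun h => hQ (by push_cast at h; linarith)

end CharP

end UnpinE

end Literature.AlgebraicGeometry.Resolution.WeightedBlowup
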